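import Summits.BirchSwinnertonDyer.BirchSwinnertonDyer.Theorems.AdditiveKolyvaginRoadManinFrameResidueProperRTameTwistArith

/-!
# Route `ManinLocalTwoThree`, crux C3 `ManinPrimeToThreeAtNine` (stmt-BirchSwinnertonDyer-22968), line
# `kato-shift-three` (es g6), stub `stub_three_dvd_shiftClass`: ODD ORTHOGONALITY WITH A HOLE AT `⟨g⟩`
# and the shift congruence `y(g·b) ≡ y(b) (mod p)` — pure character-sum arithmetic (line prover p1; helper)

The Euler-system step of the line `kato-shift-three` (HOME/es/Line-es-kato-shift-three.lean, §3
`stub_three_dvd_shiftClass`) reads Kato's `3`-adic integrality (tree fact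
`kato_neron_isIntegral_twistedSymbolSum_of_additive_three_polar`) for the ODD characters `χ (mod ℓ)` with
`χ(3) ≠ 1` only — a HOLE at the subgroup `H = ⟨3⟩ ≤ (ℤ/ℓ)^×` — and must invert the character sum over
that punctured family. This file proves the inversion and its divisibility consequence in complete
generality (any modulus `ℓ`, any unit `g`, any prime `p`), with no modular form in sight:

* `two_mul_sum_odd_char_weighted` — odd orthogonality against a weight `y : ZMod ℓ → ℂ`:
  `2 Σ_{χ odd} χ(b⁻¹) Σ_a χ(a) y(a) = φ(ℓ) (y(b) − y(−b))` (from the tree's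
  `two_mul_sum_odd_char_inv_mul_char`, bsd-wall).
* `holeWeight_eq_of_ne_one`, `holeWeight_eq_of_eq_one` — the hole indicator
  `f − Σ_{j<f} χ(g⁻¹)ʲ` (`f = orderOf g`) equals `f` if `χ(g) ≠ 1` and `0` if `χ(g) = 1` (geometric sum
  of a root of unity).
* `two_mul_sum_odd_char_hole`, `two_mul_orderOf_mul_sum_odd_char_ne_one` — **orthogonality with a
  hole**: `2 f Σ_{χ odd, χ(g) ≠ 1} χ(b⁻¹) A_y(χ) = φ(ℓ) (f (y b − y(−b)) − Σ_{j<f} (y(gʲb) − y(−gʲb)))`.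
* `dvd_orderOf_mul_sub_sum_of_hole`, `dvd_sub_of_hole` — **the shift congruence**: if `y` is
  integer-valued and odd, `p ∤ φ(ℓ)`, `p ∤ f`, and `A_y(χ)/p` is `p`-integral for every odd `χ` with
  `χ(g) ≠ 1`, then `p ∣ f·y(b) − Σ_{j<f} y(gʲ b)` and `p ∣ y(g b) − y(b)` for every unit `b`.

In the line: `ℓ` admissible (`ℓ ≡ 11 (mod 12)`), `g = 3`, `p = 3`, `y(a) = Im{0, a/ℓ}_f/(Ω⁻_f/2) ∈ ℤ`,
and `A_y(χ) = Σ_a χ(a) y(a)` is `3·(3-integral)` by the Kato fact at a lattice-optimal datum with `3 ∣ c`;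
the conclusion `3 ∣ y(3a) − y(a)` is `Im{a/ℓ, 3a/ℓ}_f ∈ 3ℤ·(Ω⁻_f/2)` (the stub). Nothing about BSD or about
Manin's conjecture is proved here.
-/

set_option autoImplicit false
set_option linter.dupNamespace false

noncomputable section

open scoped Classical

open Summit.BirchSwinnertonDyer.BirchSwinnertonDyer.Theorems.ManinFrameResidueProperRTameTwist

namespace Summit.BirchSwinnertonDyer.BirchSwinnertonDyer.Theorems.ManinLocalTwoThree

section Hole

variable {ℓ : ℕ} [NeZero ℓ]

/-- Values of a Dirichlet character are algebraic integers (roots of unity or `0`). [folklore] -/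
theorem isIntegral_dirichletCharacter_apply (χ : DirichletCharacter ℂ ℓ) (x : ZMod ℓ) :
    IsIntegral ℤ (χ x) := by
  by_cases hu : IsUnit x
  · obtain ⟨u, rfl⟩ := hu
    have h : (χ (u : ZMod ℓ)) ^ Fintype.card (ZMod ℓ)ˣ = 1 := by
      rw [← map_pow, ← Units.val_pow_eq_pow_val, pow_card_eq_one, Units.val_one, map_one]
    exact isIntegral_of_pow_eq_one Fintype.card_pos h
  · rw [χ.map_nonunit hu]; exact isIntegral_zero

/-- **Odd orthogonality against a weight.** For a unit `b` and any `y : ℤ/ℓ → ℂ`,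
`2 Σ_{χ odd} χ(b⁻¹) A_y(χ) = φ(ℓ)·(y(b) − y(−b))`. [folklore] -/
theorem two_mul_sum_odd_char_weighted (y : ZMod ℓ → ℂ) (b : ZMod ℓ) (hb : IsUnit b) :
    2 * ∑ χ ∈ (Finset.univ : Finset (DirichletCharacter ℂ ℓ)) with χ.Odd, χ b⁻¹ * (∑ a : ZMod ℓ, χ a * y a) =
      (ℓ.totient : ℂ) * (y b - y (-b)) := by
  have hswap : ∑ χ ∈ (Finset.univ : Finset (DirichletCharacter ℂ ℓ)) with χ.Odd,
      χ b⁻¹ * (∑ a : ZMod ℓ, χ a * y a) =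
      ∑ a : ZMod ℓ, (∑ χ ∈ (Finset.univ : Finset (DirichletCharacter ℂ ℓ)) with χ.Odd,
        χ b⁻¹ * χ a) * y a := by
    simp only [Finset.mul_sum, Finset.sum_mul, mul_assoc]
    exact Finset.sum_comm
  rw [hswap, Finset.mul_sum]
  simp_rw [← mul_assoc, two_mul_sum_odd_char_inv_mul_char b hb, sub_mul, Finset.sum_sub_distrib,
    ite_mul, zero_mul, Finset.sum_ite_eq, Finset.mem_univ, if_true]
  have hneg : ∑ a : ZMod ℓ, (if b = -a then (ℓ.totient : ℂ) * y a else 0) =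
      (ℓ.totient : ℂ) * y (-b) := by
    have : ∀ a : ZMod ℓ, (b = -a) = (-b = a) := by
      intro a; rw [neg_eq_iff_eq_neg]
    simp_rw [this, Finset.sum_ite_eq, Finset.mem_univ, if_true]
  rw [hneg]
  ring

omit [NeZero ℓ] in
/-- `χ(u⁻¹) = 1 ↔ χ(u) = 1`. [folklore] -/
theorem apply_inv_eq_one_iff (u : (ZMod ℓ)ˣ) (χ : DirichletCharacter ℂ ℓ) :
    χ ((u⁻¹ : (ZMod ℓ)ˣ) : ZMod ℓ) = 1 ↔ χ (u : ZMod ℓ) = 1 := by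
  have h : χ (u : ZMod ℓ) * χ ((u⁻¹ : (ZMod ℓ)ˣ) : ZMod ℓ) = 1 := by
    rw [← map_mul, ← Units.val_mul, mul_inv_cancel, Units.val_one, map_one]
  constructor
  · intro h1; rwa [h1, mul_one] at h
  · intro h1; rwa [h1, one_mul] at h

omit [NeZero ℓ] in
/-- For `χ(u) ≠ 1` the hole weight is `f`: `Σ_{j<f} ζʲ = 0` for the root of unity `ζ = χ(u⁻¹) ≠ 1`,
`ζᶠ = 1`. [folklore] -/
theorem holeWeight_eq_of_ne_one (u : (ZMod ℓ)ˣ) {χ : DirichletCharacter ℂ ℓ}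
    (hχ : χ (u : ZMod ℓ) ≠ 1) : ((orderOf u : ℂ) - ∑ j ∈ Finset.range (orderOf u), (χ ((u⁻¹ : (ZMod ℓ)ˣ) : ZMod ℓ)) ^ j) = (orderOf u : ℂ) := by
  set ζ : ℂ := χ ((u⁻¹ : (ZMod ℓ)ˣ) : ZMod ℓ) with hζ
  have hζ1 : ζ ≠ 1 := fun h ↦ hχ ((apply_inv_eq_one_iff u χ).mp h)
  have hζf : ζ ^ orderOf u = 1 := by
    rw [hζ, ← map_pow, ← Units.val_pow_eq_pow_val, inv_pow, pow_orderOf_eq_one, inv_one, Units.val_one,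
      map_one]
  have hgeom : (∑ j ∈ Finset.range (orderOf u), ζ ^ j) * (ζ - 1) = ζ ^ orderOf u - 1 :=
    geom_sum_mul _ _
  rw [hζf, sub_self] at hgeom
  have h0 : ∑ j ∈ Finset.range (orderOf u), ζ ^ j = 0 := by
    rcases mul_eq_zero.mp hgeom with h | h
    · exact h
    · exact absurd (sub_eq_zero.mp h) hζ1
  rw [h0, sub_zero]

omit [NeZero ℓ] in
/-- For `χ(u) = 1` the hole weight is `0`. [folklore] -/
theorem holeWeight_eq_of_eq_one (u : (ZMod ℓ)ˣ) {χ : DirichletCharacter ℂ ℓ}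
    (hχ : χ (u : ZMod ℓ) = 1) : ((orderOf u : ℂ) - ∑ j ∈ Finset.range (orderOf u), (χ ((u⁻¹ : (ZMod ℓ)ˣ) : ZMod ℓ)) ^ j) = 0 := by
  rw [(apply_inv_eq_one_iff u χ).mpr hχ]
  simp

/-- **Odd orthogonality with a hole at `⟨u⟩`.** For units `u` (of order `f`) and `β`, and a weight
`y`: `2 Σ_{χ odd} (f − Σ_{j<f} χ(u⁻¹)ʲ)·χ(β⁻¹)·A_y(χ) =
φ(ℓ)·(f·(y β − y(−β)) − Σ_{j<f} (y(uʲβ) − y(−uʲβ)))`. [folklore] -/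
theorem two_mul_sum_odd_char_hole (y : ZMod ℓ → ℂ) (u β : (ZMod ℓ)ˣ) :
    2 * ∑ χ ∈ (Finset.univ : Finset (DirichletCharacter ℂ ℓ)) with χ.Odd,
        ((orderOf u : ℂ) - ∑ j ∈ Finset.range (orderOf u), (χ ((u⁻¹ : (ZMod ℓ)ˣ) : ZMod ℓ)) ^ j) * (χ (β : ZMod ℓ)⁻¹ * (∑ a : ZMod ℓ, χ a * y a)) =
      (ℓ.totient : ℂ) * ((orderOf u : ℂ) * (y β - y (-(β : ZMod ℓ))) -
        ∑ j ∈ Finset.range (orderOf u),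
          (y ((u ^ j * β : (ZMod ℓ)ˣ) : ZMod ℓ) - y (-((u ^ j * β : (ZMod ℓ)ˣ) : ZMod ℓ)))) := by
  -- `χ(u⁻¹)ʲ · χ(β⁻¹) = χ((uʲ β)⁻¹)`
  have hkey : ∀ (χ : DirichletCharacter ℂ ℓ) (j : ℕ),
      (χ ((u⁻¹ : (ZMod ℓ)ˣ) : ZMod ℓ)) ^ j * χ (β : ZMod ℓ)⁻¹ =
        χ ((u ^ j * β : (ZMod ℓ)ˣ) : ZMod ℓ)⁻¹ := by
    intro χ j
    rw [ZMod.inv_coe_unit, ZMod.inv_coe_unit, ← map_pow, ← Units.val_pow_eq_pow_val, ← map_mul,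
      ← Units.val_mul, mul_inv_rev, inv_pow, mul_comm]
  -- split the hole weight
  have hsplit : ∑ χ ∈ (Finset.univ : Finset (DirichletCharacter ℂ ℓ)) with χ.Odd,
      ((orderOf u : ℂ) - ∑ j ∈ Finset.range (orderOf u), (χ ((u⁻¹ : (ZMod ℓ)ˣ) : ZMod ℓ)) ^ j) * (χ (β : ZMod ℓ)⁻¹ * (∑ a : ZMod ℓ, χ a * y a)) =
      (orderOf u : ℂ) * ∑ χ ∈ (Finset.univ : Finset (DirichletCharacter ℂ ℓ)) with χ.Odd,
        χ (β : ZMod ℓ)⁻¹ * (∑ a : ZMod ℓ, χ a * y a) -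
      ∑ j ∈ Finset.range (orderOf u),
        ∑ χ ∈ (Finset.univ : Finset (DirichletCharacter ℂ ℓ)) with χ.Odd,
          χ ((u ^ j * β : (ZMod ℓ)ˣ) : ZMod ℓ)⁻¹ * (∑ a : ZMod ℓ, χ a * y a) := by
    have hpt : ∀ χ ∈ (Finset.univ : Finset (DirichletCharacter ℂ ℓ)).filter (fun χ ↦ χ.Odd),
        ((orderOf u : ℂ) - ∑ j ∈ Finset.range (orderOf u), (χ ((u⁻¹ : (ZMod ℓ)ˣ) : ZMod ℓ)) ^ j) *
          (χ (β : ZMod ℓ)⁻¹ * (∑ a : ZMod ℓ, χ a * y a)) =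
        (orderOf u : ℂ) * (χ (β : ZMod ℓ)⁻¹ * (∑ a : ZMod ℓ, χ a * y a)) -
          ∑ j ∈ Finset.range (orderOf u),
            χ ((u ^ j * β : (ZMod ℓ)ˣ) : ZMod ℓ)⁻¹ * (∑ a : ZMod ℓ, χ a * y a) := by
      intro χ _
      rw [sub_mul, Finset.sum_mul]
      congr 1
      exact Finset.sum_congr rfl fun j _ ↦ by rw [← mul_assoc, hkey χ j]
    rw [Finset.sum_congr rfl hpt, Finset.sum_sub_distrib, ← Finset.mul_sum, Finset.sum_comm]
  have h1 := two_mul_sum_odd_char_weighted y (β : ZMod ℓ) (Units.isUnit β)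
  have hL : 2 * ∑ j ∈ Finset.range (orderOf u),
      ∑ χ ∈ (Finset.univ : Finset (DirichletCharacter ℂ ℓ)) with χ.Odd,
        χ ((u ^ j * β : (ZMod ℓ)ˣ) : ZMod ℓ)⁻¹ * (∑ a : ZMod ℓ, χ a * y a) =
      (ℓ.totient : ℂ) * ∑ j ∈ Finset.range (orderOf u),
        (y ((u ^ j * β : (ZMod ℓ)ˣ) : ZMod ℓ) - y (-((u ^ j * β : (ZMod ℓ)ˣ) : ZMod ℓ))) := by
    rw [Finset.mul_sum, Finset.mul_sum]
    exact Finset.sum_congr rfl fun j _ ↦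
      two_mul_sum_odd_char_weighted y _ (Units.isUnit (u ^ j * β))
  rw [hsplit, mul_sub, show (2 : ℂ) * ((orderOf u : ℂ) *
      ∑ χ ∈ (Finset.univ : Finset (DirichletCharacter ℂ ℓ)) with χ.Odd,
        χ (β : ZMod ℓ)⁻¹ * (∑ a : ZMod ℓ, χ a * y a)) = (orderOf u : ℂ) * (2 *
      ∑ χ ∈ (Finset.univ : Finset (DirichletCharacter ℂ ℓ)) with χ.Odd,
        χ (β : ZMod ℓ)⁻¹ * (∑ a : ZMod ℓ, χ a * y a)) by ring, h1, hL]
  ring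

/-- The same with the hole made explicit: `2 f Σ_{χ odd, χ(u) ≠ 1} χ(β⁻¹) A_y(χ) =
φ(ℓ)·(f·(y β − y(−β)) − Σ_{j<f} (y(uʲβ) − y(−uʲβ)))`. [folklore] -/
theorem two_mul_orderOf_mul_sum_odd_char_ne_one (y : ZMod ℓ → ℂ) (u β : (ZMod ℓ)ˣ) :
    2 * ((orderOf u : ℂ) * ∑ χ ∈ (Finset.univ : Finset (DirichletCharacter ℂ ℓ)) with
        (χ.Odd ∧ χ (u : ZMod ℓ) ≠ 1), χ (β : ZMod ℓ)⁻¹ * (∑ a : ZMod ℓ, χ a * y a)) =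
      (ℓ.totient : ℂ) * ((orderOf u : ℂ) * (y β - y (-(β : ZMod ℓ))) -
        ∑ j ∈ Finset.range (orderOf u),
          (y ((u ^ j * β : (ZMod ℓ)ˣ) : ZMod ℓ) - y (-((u ^ j * β : (ZMod ℓ)ˣ) : ZMod ℓ)))) := by
  rw [← two_mul_sum_odd_char_hole y u β]
  congr 1
  -- pointwise: `holeWeight · T = if χ u ≠ 1 then f · T else 0`
  have hpt : ∀ χ ∈ (Finset.univ : Finset (DirichletCharacter ℂ ℓ)).filter (fun χ ↦ χ.Odd),
      ((orderOf u : ℂ) - ∑ j ∈ Finset.range (orderOf u), (χ ((u⁻¹ : (ZMod ℓ)ˣ) : ZMod ℓ)) ^ j) * (χ (β : ZMod ℓ)⁻¹ * (∑ a : ZMod ℓ, χ a * y a)) =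
        if χ (u : ZMod ℓ) ≠ 1 then (orderOf u : ℂ) * (χ (β : ZMod ℓ)⁻¹ * (∑ a : ZMod ℓ, χ a * y a)) else 0 := by
    intro χ _
    by_cases h : χ (u : ZMod ℓ) = 1
    · rw [if_neg (not_not.mpr h), holeWeight_eq_of_eq_one u h, zero_mul]
    · rw [if_pos h, holeWeight_eq_of_ne_one u h]
  rw [Finset.sum_congr rfl hpt, ← Finset.sum_filter, Finset.filter_filter, Finset.mul_sum]

end Hole

/-! ### The shift congruence -/

section Shift

variable {ℓ : ℕ} [NeZero ℓ] {p : ℕ}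

/-- **The shift congruence, sum form.** `y : ℤ/ℓ → ℤ` odd, `u`, `β` units, `f = orderOf u`; if
`p ∤ φ(ℓ)`, and `A_y(χ)/p` is `p`-integral for every ODD `χ` with `χ(u) ≠ 1`, then
`p ∣ f·y(β) − Σ_{j<f} y(uʲ β)`. [folklore] -/
theorem dvd_orderOf_mul_sub_sum_of_hole (hp : p.Prime) (y : ZMod ℓ → ℤ)
    (hodd : ∀ a, y (-a) = -y a) (u β : (ZMod ℓ)ˣ) (hφ : ¬ p ∣ ℓ.totient)
    (hA : ∀ χ : DirichletCharacter ℂ ℓ, χ.Odd → χ (u : ZMod ℓ) ≠ 1 →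
      ∃ s : ℕ, ¬ p ∣ s ∧ IsIntegral ℤ ((s : ℂ) * ((∑ a : ZMod ℓ, χ a * (y a : ℂ)) / p))) :
    (p : ℤ) ∣ (orderOf u : ℤ) * y β - ∑ j ∈ Finset.range (orderOf u), y ((u ^ j * β : (ZMod ℓ)ˣ)) := by
  haveI : Fact p.Prime := ⟨hp⟩
  set K : ℤ := (orderOf u : ℤ) * y β - ∑ j ∈ Finset.range (orderOf u), y ((u ^ j * β : (ZMod ℓ)ˣ))
    with hK
  -- the identity, for the odd weight, reads `f · Σ' = φ(ℓ) · K`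
  have hid := two_mul_orderOf_mul_sum_odd_char_ne_one (fun a ↦ (y a : ℂ)) u β
  have hrhs : (ℓ.totient : ℂ) * ((orderOf u : ℂ) * ((y β : ℂ) - (y (-(β : ZMod ℓ)) : ℂ)) -
      ∑ j ∈ Finset.range (orderOf u),
        ((y ((u ^ j * β : (ZMod ℓ)ˣ) : ZMod ℓ) : ℂ) - (y (-((u ^ j * β : (ZMod ℓ)ˣ) : ZMod ℓ)) : ℂ))) =
      2 * ((ℓ.totient : ℂ) * (K : ℂ)) := by
    have h2 : ∀ x : ZMod ℓ, ((y x : ℂ) - (y (-x) : ℂ)) = 2 * (y x : ℂ) := by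
      intro x; rw [hodd]; push_cast; ring
    simp_rw [h2, ← Finset.mul_sum, hK]
    push_cast
    ring
  rw [hrhs] at hid
  have hid' : (orderOf u : ℂ) * ∑ χ ∈ (Finset.univ : Finset (DirichletCharacter ℂ ℓ)) with
      (χ.Odd ∧ χ (u : ZMod ℓ) ≠ 1), χ (β : ZMod ℓ)⁻¹ * (∑ a : ZMod ℓ, χ a * (y a : ℂ)) =
      (ℓ.totient : ℂ) * (K : ℂ) :=
    mul_left_cancel₀ two_ne_zero hid
  -- the left side divided by `p` is `p`-integral
  have hpint : ∃ s : ℕ, ¬ p ∣ s ∧ IsIntegral ℤ ((s : ℂ) *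
      ((orderOf u : ℂ) * ∑ χ ∈ (Finset.univ : Finset (DirichletCharacter ℂ ℓ)) with
        (χ.Odd ∧ χ (u : ZMod ℓ) ≠ 1), χ (β : ZMod ℓ)⁻¹ * ((∑ a : ZMod ℓ, χ a * (y a : ℂ)) / p))) := by
    refine pint_mul hp (pint_of_isIntegral hp ?_) (pint_sum hp _ _ fun χ hχ ↦ ?_)
    · exact_mod_cast (isIntegral_algebraMap (R := ℤ) (A := ℂ) (x := (orderOf u : ℤ)))
    obtain ⟨hχo, hχu⟩ := (Finset.mem_filter.mp hχ).2
    exact pint_mul hp (pint_of_isIntegral hp (isIntegral_dirichletCharacter_apply χ _)) (hA χ hχo hχu)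
  have hdiv : (orderOf u : ℂ) * ∑ χ ∈ (Finset.univ : Finset (DirichletCharacter ℂ ℓ)) with
      (χ.Odd ∧ χ (u : ZMod ℓ) ≠ 1), χ (β : ZMod ℓ)⁻¹ * ((∑ a : ZMod ℓ, χ a * (y a : ℂ)) / p) =
      (((((ℓ.totient : ℤ) * K : ℤ) : ℚ) / p : ℚ) : ℂ) := by
    have : ∑ χ ∈ (Finset.univ : Finset (DirichletCharacter ℂ ℓ)) with (χ.Odd ∧ χ (u : ZMod ℓ) ≠ 1),
        χ (β : ZMod ℓ)⁻¹ * ((∑ a : ZMod ℓ, χ a * (y a : ℂ)) / p) =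
        (∑ χ ∈ (Finset.univ : Finset (DirichletCharacter ℂ ℓ)) with (χ.Odd ∧ χ (u : ZMod ℓ) ≠ 1),
          χ (β : ZMod ℓ)⁻¹ * (∑ a : ZMod ℓ, χ a * (y a : ℂ))) / p := by
      rw [Finset.sum_div]
      exact Finset.sum_congr rfl fun _ _ ↦ by ring
    rw [this, ← mul_div_assoc, hid']
    push_cast
    ring
  rw [hdiv] at hpint
  have hval := padicValRat_nonneg_of_pint (p := p) hpint
  -- `0 ≤ ord_p (φ(ℓ) K / p)` ⟹ `p ∣ φ(ℓ) K` ⟹ `p ∣ K`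
  by_contra hK0
  have hK0' : K ≠ 0 := by rintro h; exact hK0 (h ▸ dvd_zero _)
  have hne : ((ℓ.totient : ℤ) * K) ≠ 0 :=
    mul_ne_zero (by exact_mod_cast (Nat.totient_pos.mpr (NeZero.pos ℓ)).ne') hK0'
  have hndvd : ¬ (p : ℤ) ∣ (ℓ.totient : ℤ) * K := by
    intro h
    rcases Int.Prime.dvd_mul' hp h with h1 | h2
    · exact hφ (by exact_mod_cast h1)
    · exact hK0 h2
  have h0 : padicValRat p ((((ℓ.totient : ℤ) * K : ℤ) : ℚ) / p) = -1 := by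
    rw [padicValRat.div (by exact_mod_cast hne) (by exact_mod_cast hp.ne_zero),
      padicValRat.of_int, padicValRat.self hp.one_lt,
      padicValInt.eq_zero_of_not_dvd hndvd]
    simp
  rw [h0] at hval
  norm_num at hval

/-- **The shift congruence `y(u·β) ≡ y(β) (mod p)`.** Under the hypotheses of
`dvd_orderOf_mul_sub_sum_of_hole` and `p ∤ f`: the sums `Σ_{j<f} y(uʲ·β)` and `Σ_{j<f} y(uʲ·(u β))`
agree (`uᶠ = 1`), so `p ∣ f·(y(u β) − y(β))`, hence `p ∣ y(u β) − y(β)`. [folklore] -/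
theorem dvd_sub_of_hole (hp : p.Prime) (y : ZMod ℓ → ℤ) (hodd : ∀ a, y (-a) = -y a)
    (u β : (ZMod ℓ)ˣ) (hφ : ¬ p ∣ ℓ.totient) (hf : ¬ p ∣ orderOf u)
    (hA : ∀ χ : DirichletCharacter ℂ ℓ, χ.Odd → χ (u : ZMod ℓ) ≠ 1 →
      ∃ s : ℕ, ¬ p ∣ s ∧ IsIntegral ℤ ((s : ℂ) * ((∑ a : ZMod ℓ, χ a * (y a : ℂ)) / p))) :
    (p : ℤ) ∣ y ((u * β : (ZMod ℓ)ˣ)) - y β := by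
  have h1 := dvd_orderOf_mul_sub_sum_of_hole hp y hodd u β hφ hA
  have h2 := dvd_orderOf_mul_sub_sum_of_hole hp y hodd u (u * β) hφ hA
  -- the two sums agree
  have hsum : ∑ j ∈ Finset.range (orderOf u), y ((u ^ j * (u * β) : (ZMod ℓ)ˣ)) =
      ∑ j ∈ Finset.range (orderOf u), y ((u ^ j * β : (ZMod ℓ)ˣ)) := by
    have hstep : ∀ j, y ((u ^ j * (u * β) : (ZMod ℓ)ˣ)) = y ((u ^ (j + 1) * β : (ZMod ℓ)ˣ)) :=
      fun j ↦ by rw [pow_succ, mul_assoc]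
    simp_rw [hstep]
    obtain ⟨n, hn⟩ : ∃ n, orderOf u = n + 1 := ⟨orderOf u - 1, by have := orderOf_pos u; omega⟩
    rw [hn, Finset.sum_range_succ (fun j ↦ y ((u ^ (j + 1) * β : (ZMod ℓ)ˣ))),
      Finset.sum_range_succ' (fun j ↦ y ((u ^ j * β : (ZMod ℓ)ˣ)))]
    rw [pow_zero, one_mul, ← hn, pow_orderOf_eq_one, one_mul]
  rw [hsum] at h2
  have h3 : (p : ℤ) ∣ (orderOf u : ℤ) * (y ((u * β : (ZMod ℓ)ˣ)) - y β) := by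
    have := dvd_sub h2 h1
    rw [show (orderOf u : ℤ) * y ((u * β : (ZMod ℓ)ˣ)) -
        ∑ j ∈ Finset.range (orderOf u), y ((u ^ j * β : (ZMod ℓ)ˣ)) -
      ((orderOf u : ℤ) * y β - ∑ j ∈ Finset.range (orderOf u), y ((u ^ j * β : (ZMod ℓ)ˣ))) =
      (orderOf u : ℤ) * (y ((u * β : (ZMod ℓ)ˣ)) - y β) by ring] at this
    exact this
  rcases Int.Prime.dvd_mul' hp h3 with h | h
  · exact absurd (by exact_mod_cast h) hf
  · exact h

end Shift

end Summit.BirchSwinnertonDyer.BirchSwinnertonDyer.Theorems.ManinLocalTwoThree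

end
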